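import Summits.CriticalPhenomena.PercolationContinuityZ3.Theorems.PercNearOneGluingNoHeavyLowerTailSahiClassTLambdaTwo
import Mathlib.Tactic.Linarith
import Mathlib.Tactic.Ring
import HarnessLib

/-!
# `NoHeavyLowerTail` (crux stmt-CriticalPhenomena-4575), P2 — the λ = 2 rung on class T, II: **Boolean cubes with product Bernoulli weights**,
# `p_e²·E_3(μ_{p[e↦1]}) + (1−p_e)²·E_3(μ_{p[e↦0]}) ≤ E_3(μ_p)`

Support file (seat `prim-masterthm-p2`, gen 14; `--supports stmt-CriticalPhenomena-4575`).  No definition, no `sorry`, standard axioms.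
Companion of `…SahiClassTLambdaTwo` (the theorem on `α × β × Finset ι` for a log-modular cube weight and abstract conditionings `w¹, w⁰`);
here the transport to three Boolean cubes `2^C × 2^A × 2^B` with `bernoulliWeight` and `Function.update` (the programme's percolation setting):

* `coe_mul_bernoulliWeight_update_one/zero` — `p_e·μ_{p[e↦1]} = 1_{e∈·}·μ_p`, `(1−p_e)·μ_{p[e↦0]} = 1_{e∉·}·μ_p`;
* `sahiE_three_setCube_eq` — relabelling `Finset κ ≃ Set κ` of the class-T `E_3` (`sahiE_pushWeight`);
* **`sq_mul_sahiE_three_add_le_cubes`** — for ALL nonnegative coordinatewise monotone `f : 2^C × 2^A → ℝ`, `g : 2^C × 2^B → ℝ`, `h : 2^A × 2^B → ℝ`,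
  every `p` and every `e ∈ C`:  `p_e²·E_3(μ_{p[e↦1]}) + (1−p_e)²·E_3(μ_{p[e↦0]}) ≤ E_3(μ_p)` — i.e. `β₁(e) ≥ 0` for the quadratic fibre: BGC and the
  λ = 2 forms `3B₁ ≥ B₀`, `3B₂ ≥ B₃` (bnk-2's `SahiTwoLevelMinus/Plus` at these sections) at every 2-shared coordinate of every class-T triple;
* `sq_mul_sahiE_three_one_le_cubes` (`E_3(μ_p) ≥ p_e²·E_3(μ_{p[e↦1]})`), `sq_mul_sahiE_three_zero_le_cubes` (`E_3(μ_p) ≥ (1−p_e)²·E_3(μ_{p[e↦0]})`) —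
  the λ = 2 antitone readings (the λ = 1 reading `E_3(μ_p) ≥ p_e·E_3(μ_{p[e↦1]})` = (T3∀) is FALSE on class T, `…SahiCoordinateTwoThirdsFalse`).
By the symmetry of `E_3` and of class T the statements hold at every coordinate of a class-T triple (permute the members).  HONEST FRAMING:
off class T, BGC-all / `SahiTwoLevelPlus` / Kahn's `C_3` remain OPEN. [this work]
-/

noncomputable section

open scoped Classical

namespace Summit.CriticalPhenomena.PercolationContinuityZ3.Theorems

namespace SahiClassTLambdaTwo

open Finset
open Literature.Combinatorics.Sahi2008

section SetCube

open Function
open Literature.Probability.Percolation.BHK2006 (weight weight_nonneg weight_inter_mul_union)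

variable {κ : Type} [Fintype κ]

/-- `p_e · μ_{p[e↦1]} = 1_{e ∈ ·} · μ_p` for the product weight. [folklore] -/
theorem coe_mul_bernoulliWeight_update_one (p : κ → unitInterval) (e : κ) (s : Set κ) :
    (p e : ℝ) * bernoulliWeight (update p e 1) s = if e ∈ s then bernoulliWeight p s else 0 := by
  simp only [bernoulliWeight, weight]
  rw [← Finset.mul_prod_erase univ _ (mem_univ e),
    ← Finset.mul_prod_erase univ (fun i => if i ∈ s then ((p i : ℝ)) else 1 - (p i : ℝ)) (mem_univ e)]
  have hrest : ∏ i ∈ univ.erase e, (if i ∈ s then ((update p e 1 i : unitInterval) : ℝ) else 1 - ((update p e 1 i : unitInterval) : ℝ)) =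
      ∏ i ∈ univ.erase e, (if i ∈ s then (p i : ℝ) else 1 - (p i : ℝ)) :=
    prod_congr rfl fun i hi => by rw [update_of_ne (ne_of_mem_erase hi)]
  rw [hrest, update_self]
  by_cases he : e ∈ s
  · simp only [he, if_true, Set.Icc.coe_one]; ring
  · simp only [he, if_false, Set.Icc.coe_one, sub_self, zero_mul, mul_zero]

/-- `(1 − p_e) · μ_{p[e↦0]} = 1_{e ∉ ·} · μ_p` for the product weight. [folklore] -/
theorem coe_mul_bernoulliWeight_update_zero (p : κ → unitInterval) (e : κ) (s : Set κ) :
    (1 - (p e : ℝ)) * bernoulliWeight (update p e 0) s = if e ∈ s then 0 else bernoulliWeight p s := by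
  simp only [bernoulliWeight, weight]
  rw [← Finset.mul_prod_erase univ _ (mem_univ e),
    ← Finset.mul_prod_erase univ (fun i => if i ∈ s then ((p i : ℝ)) else 1 - (p i : ℝ)) (mem_univ e)]
  have hrest : ∏ i ∈ univ.erase e, (if i ∈ s then ((update p e 0 i : unitInterval) : ℝ) else 1 - ((update p e 0 i : unitInterval) : ℝ)) =
      ∏ i ∈ univ.erase e, (if i ∈ s then (p i : ℝ) else 1 - (p i : ℝ)) :=
    prod_congr rfl fun i hi => by rw [update_of_ne (ne_of_mem_erase hi)]
  rw [hrest, update_self]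
  by_cases he : e ∈ s
  · simp only [he, if_true, Set.Icc.coe_zero, zero_mul, mul_zero]
  · simp only [he, if_false, Set.Icc.coe_zero, sub_zero, one_mul]

variable {A' B' : Type} [Fintype A'] [Fintype B']

/-- Transport of the class-T `E_3` from the Boolean lattice `Set κ` to the cube `Finset κ` (relabelling along
`Finset κ ≃ Set κ`; `sahiE_pushWeight`). [this work] -/
theorem sahiE_three_setCube_eq (wA : A' → ℝ) (wB : B' → ℝ) (W : Set κ → ℝ)
    (f : Set κ → A' → ℝ) (g : Set κ → B' → ℝ) (h : A' → B' → ℝ) :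
    sahiE (fun q : A' × B' × Set κ => wA q.1 * wB q.2.1 * W q.2.2) 3
        ![fun q => f q.2.2 q.1, fun q => g q.2.2 q.2.1, fun q => h q.1 q.2.1] =
      sahiE (fun q : A' × B' × Finset κ => wA q.1 * wB q.2.1 * W ↑q.2.2) 3
        ![fun q => f ↑q.2.2 q.1, fun q => g ↑q.2.2 q.2.1, fun q => h q.1 q.2.1] := by
  set eqv : Finset κ ≃ Set κ := Fintype.finsetEquivSet
  have he : ∀ x : Finset κ, eqv x = (↑x : Set κ) := fun x => rfl
  let E : A' × B' × Finset κ ≃ A' × B' × Set κ := (Equiv.refl A').prodCongr ((Equiv.refl B').prodCongr eqv)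
  have hpush : (fun q : A' × B' × Set κ => wA q.1 * wB q.2.1 * W q.2.2) =
      pushWeight (fun q : A' × B' × Finset κ => wA q.1 * wB q.2.1 * W (eqv q.2.2)) E := by
    funext q
    rw [pushWeight_equiv]
    simp [E]
  rw [hpush, sahiE_pushWeight]
  have hfun : (fun i => (![fun q : A' × B' × Set κ => f q.2.2 q.1, fun q => g q.2.2 q.2.1, fun q => h q.1 q.2.1] i) ∘ ⇑E) =
      ![fun q : A' × B' × Finset κ => f (eqv q.2.2) q.1, fun q => g (eqv q.2.2) q.2.1, fun q => h q.1 q.2.1] := by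
    funext i q
    fin_cases i <;> simp [E]
  rw [hfun]
  rfl

variable {A B C : Type} [Fintype A] [Fintype B] [Fintype C]

/-- **THEOREM (λ = 2 / BGC on class T, Boolean cubes).**  Three Boolean cubes with product (Bernoulli) measures and ARBITRARY nonnegative
coordinatewise monotone `f : 2^C × 2^A → ℝ`, `g : 2^C × 2^B → ℝ`, `h : 2^A × 2^B → ℝ` (class T: no coordinate essential to all three
members).  For every coordinate `e` of the `f`–`g` block `C`,
  `p_e²·E_3(μ_{p[e↦1]}) + (1−p_e)²·E_3(μ_{p[e↦0]}) ≤ E_3(μ_p)`,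
i.e. (the fibre `s ↦ E_3(μ_{p[e↦s]})` being the quadratic `β₀(1−s)² + 2β₁s(1−s) + β₂s²`) **`β₁(e) ≥ 0`**: master-conj's BGC and the λ = 2 forms
`3B₁ ≥ B₀`, `3B₂ ≥ B₃` (`= 2β₁`) hold at every 2-shared coordinate of every class-T triple (by the symmetry of `E_3` and of class T, at every
coordinate).  SAHI-ROUTE §4.33/§4.36(j). [this work] -/
theorem sq_mul_sahiE_three_add_le_cubes (pA : A → unitInterval) (pB : B → unitInterval) (pC : C → unitInterval)
    (f : Set C → Set A → ℝ) (g : Set C → Set B → ℝ) (h : Set A → Set B → ℝ)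
    (hf0 : ∀ c a, 0 ≤ f c a) (hfa : ∀ c, Monotone (f c)) (hfc : ∀ a, Monotone (fun c => f c a))
    (hg0 : ∀ c b, 0 ≤ g c b) (hgb : ∀ c, Monotone (g c)) (hgc : ∀ b, Monotone (fun c => g c b))
    (hh0 : ∀ a b, 0 ≤ h a b) (hha : ∀ b, Monotone (fun a => h a b)) (hhb : ∀ a, Monotone (h a)) (e : C) :
    (pC e : ℝ) ^ 2 * sahiE (fun q : Set A × Set B × Set C =>
        bernoulliWeight pA q.1 * bernoulliWeight pB q.2.1 * bernoulliWeight (update pC e 1) q.2.2) 3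
        ![fun q => f q.2.2 q.1, fun q => g q.2.2 q.2.1, fun q => h q.1 q.2.1] +
      (1 - (pC e : ℝ)) ^ 2 * sahiE (fun q : Set A × Set B × Set C =>
        bernoulliWeight pA q.1 * bernoulliWeight pB q.2.1 * bernoulliWeight (update pC e 0) q.2.2) 3
        ![fun q => f q.2.2 q.1, fun q => g q.2.2 q.2.1, fun q => h q.1 q.2.1] ≤
      sahiE (fun q : Set A × Set B × Set C =>
        bernoulliWeight pA q.1 * bernoulliWeight pB q.2.1 * bernoulliWeight pC q.2.2) 3
        ![fun q => f q.2.2 q.1, fun q => g q.2.2 q.2.1, fun q => h q.1 q.2.1] := by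
  rw [sahiE_three_setCube_eq, sahiE_three_setCube_eq, sahiE_three_setCube_eq]
  have hmono : ∀ {x y : Finset C}, x ⊆ y → (↑x : Set C) ≤ ↑y := fun hxy => Finset.coe_subset.2 hxy
  have hsum : ∀ q : C → unitInterval, ∑ x : Finset C, bernoulliWeight q (↑x : Set C) = 1 := fun q => by
    rw [show (∑ x : Finset C, bernoulliWeight q (↑x : Set C)) = ∑ s, bernoulliWeight q s from
      (Fintype.finsetEquivSet (α := C)).sum_comp (bernoulliWeight q), sum_bernoulliWeight]
  refine sq_mul_sahiE_three_add_le (ι := C) (wA := bernoulliWeight pA) (wB := bernoulliWeight pB)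
    (f := fun x a => f ↑x a) (g := fun x b => g ↑x b) (h := h)
    (isFKGMeasure_bernoulliWeight pA) (isFKGMeasure_bernoulliWeight pB)
    (fun c a => hf0 _ a) (fun c => hfa _) (fun a x y hxy => hfc a (hmono hxy))
    (fun c b => hg0 _ b) (fun c => hgb _) (fun b x y hxy => hgc b (hmono hxy)) hh0 hha hhb
    e (pC e).2.1 (pC e).2.2 (w := fun x => bernoulliWeight pC ↑x) (w1 := fun x => bernoulliWeight (update pC e 1) ↑x)
    (w0 := fun x => bernoulliWeight (update pC e 0) ↑x)
    (fun x => (isFKGMeasure_bernoulliWeight pC).nonneg _) (hsum pC) ?_ (hsum _) (hsum _) ?_ ?_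
  · intro x y
    rw [Finset.coe_inter, Finset.coe_union]
    exact weight_inter_mul_union _ _ _
  · intro x
    rw [coe_mul_bernoulliWeight_update_one]
    simp only [Finset.mem_coe]
  · intro x
    rw [coe_mul_bernoulliWeight_update_zero]
    simp only [Finset.mem_coe]

/-- **λ = 2, top form**: `E_3(μ_p) ≥ p_e²·E_3(μ_{p[e↦1]})` ("conditioning all three members on `x_e = 1` costs at most the factor
`p_e^{−2}`"; the factor `p_e^{−1}` of (T3∀) is FALSE, `…SahiCoordinateTwoThirdsFalse`).  Class T, `e` in the `f`–`g` block. [this work] -/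
theorem sq_mul_sahiE_three_one_le_cubes (pA : A → unitInterval) (pB : B → unitInterval) (pC : C → unitInterval)
    (f : Set C → Set A → ℝ) (g : Set C → Set B → ℝ) (h : Set A → Set B → ℝ)
    (hf0 : ∀ c a, 0 ≤ f c a) (hfa : ∀ c, Monotone (f c)) (hfc : ∀ a, Monotone (fun c => f c a))
    (hg0 : ∀ c b, 0 ≤ g c b) (hgb : ∀ c, Monotone (g c)) (hgc : ∀ b, Monotone (fun c => g c b))
    (hh0 : ∀ a b, 0 ≤ h a b) (hha : ∀ b, Monotone (fun a => h a b)) (hhb : ∀ a, Monotone (h a)) (e : C) :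
    (pC e : ℝ) ^ 2 * sahiE (fun q : Set A × Set B × Set C =>
        bernoulliWeight pA q.1 * bernoulliWeight pB q.2.1 * bernoulliWeight (update pC e 1) q.2.2) 3
        ![fun q => f q.2.2 q.1, fun q => g q.2.2 q.2.1, fun q => h q.1 q.2.1] ≤
      sahiE (fun q : Set A × Set B × Set C =>
        bernoulliWeight pA q.1 * bernoulliWeight pB q.2.1 * bernoulliWeight pC q.2.2) 3
        ![fun q => f q.2.2 q.1, fun q => g q.2.2 q.2.1, fun q => h q.1 q.2.1] := by
  have h3 := sq_mul_sahiE_three_add_le_cubes pA pB pC f g h hf0 hfa hfc hg0 hgb hgc hh0 hha hhb e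
  have h0 := SahiTriangleClassT.sahiE_three_nonneg_cubes_triangle pA pB (update pC e 0) f g h hf0 hfa hfc hg0 hgb hgc hh0 hha hhb
  nlinarith [sq_nonneg (1 - (pC e : ℝ))]

/-- **λ = 2, bottom form**: `E_3(μ_p) ≥ (1−p_e)²·E_3(μ_{p[e↦0]})`.  Class T, `e` in the `f`–`g` block. [this work] -/
theorem sq_mul_sahiE_three_zero_le_cubes (pA : A → unitInterval) (pB : B → unitInterval) (pC : C → unitInterval)
    (f : Set C → Set A → ℝ) (g : Set C → Set B → ℝ) (h : Set A → Set B → ℝ)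
    (hf0 : ∀ c a, 0 ≤ f c a) (hfa : ∀ c, Monotone (f c)) (hfc : ∀ a, Monotone (fun c => f c a))
    (hg0 : ∀ c b, 0 ≤ g c b) (hgb : ∀ c, Monotone (g c)) (hgc : ∀ b, Monotone (fun c => g c b))
    (hh0 : ∀ a b, 0 ≤ h a b) (hha : ∀ b, Monotone (fun a => h a b)) (hhb : ∀ a, Monotone (h a)) (e : C) :
    (1 - (pC e : ℝ)) ^ 2 * sahiE (fun q : Set A × Set B × Set C =>
        bernoulliWeight pA q.1 * bernoulliWeight pB q.2.1 * bernoulliWeight (update pC e 0) q.2.2) 3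
        ![fun q => f q.2.2 q.1, fun q => g q.2.2 q.2.1, fun q => h q.1 q.2.1] ≤
      sahiE (fun q : Set A × Set B × Set C =>
        bernoulliWeight pA q.1 * bernoulliWeight pB q.2.1 * bernoulliWeight pC q.2.2) 3
        ![fun q => f q.2.2 q.1, fun q => g q.2.2 q.2.1, fun q => h q.1 q.2.1] := by
  have h3 := sq_mul_sahiE_three_add_le_cubes pA pB pC f g h hf0 hfa hfc hg0 hgb hgc hh0 hha hhb e
  have h1 := SahiTriangleClassT.sahiE_three_nonneg_cubes_triangle pA pB (update pC e 1) f g h hf0 hfa hfc hg0 hgb hgc hh0 hha hhb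
  nlinarith [sq_nonneg (pC e : ℝ)]

end SetCube

end SahiClassTLambdaTwo

end Summit.CriticalPhenomena.PercolationContinuityZ3.Theorems
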